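/-
Copyright (c) 2026 the pub-hodgecm-mathlib formalisation cell (harness21).  Prover seat hodgecm-mathlib-LH10-p01 (g13): road M6 → F5 → dyadic chain of `stub_DyUnramCore` (D-UNR),
site (L2-3) «THE WALL», row 8 «CENTRE-SHIFT-θ» of CENSUS-L23-CM v1 (LH10-p01 (g12)) — the ADMISSIBLE EISENSTEIN CENTRE of a 2-deep type-(2) block under the hermitian Cayley shift;
2026-09-03.
-/
import Literature.NumberTheory.Automorphic.TypeTwoHermitianMoebiusShiftValued   -- ★ P2 p853646 (LH10-p01 (g12)): `eval_charpoly_genMoebius_fin_two`, `smul_one_add_smul_add_smul_one_of_add_eq`; brings ★ γ₁ (`shift_parameter_facts`, `eq_one_add_smul_inv_smul_sub_one`), ★ α (`det_smul_add_smul_one_fin_two`, `trace_mul_inv_mul_det_fin_two`)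
import Literature.NumberTheory.Automorphic.UnitaryLatticeTreeLevelShift        -- ★ p845386: `v_det_eq_one_of_forall_v_sub_one_lt_one` (`M ≡ 1 (𝔪)` ⇒ `|det M| = 1`)
import HarnessLib

/-!
# The admissible Eisenstein centre of a 2-deep type-(2) block under the hermitian Cayley shift: depth `j ↦ j − 1` (2-free)

Topic `NumberTheory/Automorphic`; namespace `Literature.NumberTheory.Automorphic.MoebiusShift`.  THEOREMS ONLY (no definition, no instance, no notation, no named fact, no `sorry`);
kernel lane `--supports stmt-HodgeConjecture-24833`.  Cell `pub/hodgecm-mathlib` (D-0151), crux H413 = `stmt-HodgeConjecture-24833`; road M6 → F5 → the dyadic chain of organ (D-UNR)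
`stub_DyUnramCore`, LEVEL TWO, site (L2-3) «THE WALL» = ★ `liftInterior_of_levelTwo` with its `h2 : IsUnit 2` deleted.  Row 8 of CENSUS-L23-CM v1: the wall's type-(2) S-rows
★ :396 read the depths of `γ_H` and of its shift `u_H` in the ODD-DISCRIMINANT currency `|tr² − 4 det|_w = exp(−(2N+1))` (★ `exists_irredExponents_of_hint … h2V`, ★ :321), which no
dyadic port can feed (the law is false at `v ∣ 2`: `χ = X² + 1`, `disc = −4` of even order); the 2-free S-rows ★ p853676 `stableOrbitalIntegralRel_chi_shift_of_not_exists_isRoot_affine`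
(LH4-p01 (g12)) read them instead off ADMISSIBLE EISENSTEIN CENTRES `(a, f, e′, j)` of the `2 × 2` blocks — `|a| ≤ 1`, `tr g − 2a = f`, `|f| ≤ |ϖ|^{j+1}`, `a² − tr g·a + det g = −e′`,
`|e′| = |ϖ|^{2j+1}` — for `γ_H` (depth `j`) AND for `u_H = φ_θ(γ_H)` (depth `j − 1`), and leave «how the centre of `u_H` is obtained from that of `γ_H` under the hermitian Cayley
shift» to the binders.  THIS FILE is that lemma, for the hermitian pair `(θ, c−θ ∣ c−θ′, θ′)`, `θ + θ′ = 1`, `θ` integral, shift parameter `c = ϖ` (`|c| = exp(−1)`), over ANY valued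
field (no `σ`, no unitarity, no `|2| = 1`):

**`hermitianMoebius_admissibleCentre`.**  Let `g` be `2 × 2` with `g ≡ 1 (mod c²)` entrywise and let `(a, f, e′, j)`, `j ≥ 1`, be an admissible centre of `g` (the
hypothesis `|a| ≤ 1` is not needed).  Put
`g′ := φ_θ(g) = (θ•g + (c−θ)•1)((c−θ′)•g + θ′•1)⁻¹` and `a₁ := φ_θ(a) = (θa + (c−θ))∕((c−θ′)a + θ′)`.  Then `|a₁| ≤ 1` and `(a₁, tr g′ − 2a₁, −χ_{g′}(a₁), j − 1)` is an
admissible centre of `g′`: `|tr g′ − 2a₁| ≤ |c|^{(j−1)+1}` and `|a₁² − tr g′·a₁ + det g′| = |c|^{2(j−1)+1}`.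

THE MATHEMATICS (explicit `2 × 2` algebra; `t = tr g`, `D = det g`, `N(x) = θx + (c−θ)`, `D(x) = (c−θ′)x + θ′`, `Δ = θθ′ − (c−θ)(c−θ′) = c(1−c)`, `χ(x) = x² − tx + D`).
(1) DENOMINATORS: `(c−θ′)•g + θ′•1 = c•(1 + (c−θ′)X)`, `X = c⁻¹(g − 1) ≡ 0 (mod c)`, so `|det D(g)| = |c|²` and likewise `|det N(g)| = |c|²` (★ `v_det_eq_one_of_forall_v_sub_one_lt_one`);
`tr D(g) = (c−θ′)(t − 2) + 2c`, `tr N(g) = θ(t−2) + 2c` have valuation `≤ |c|`.  (2) THE CENTRE SITS AT VALUATION `|c|` UNDER BOTH AFFINE MAPS: `D(a)² − tr D(g)·D(a) + det D(g)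
= (c−θ′)²·χ(a)` (the characteristic polynomial of `(c−θ′)g + θ′` at `(c−θ′)a + θ′`), whose right side has valuation `≤ |c|^{2j+1} < |c|²`; a root-free trichotomy
(`valued_eq_of_quadratic_near_root`: `x² − Tx + d = ε`, `|T| ≤ |c|`, `|d| = |c|²`, `|ε| < |c|²` ⇒ `|x| = |c|`) gives `|D(a)| = |c|`, and the same for `N(a)`; hence `|a₁| = 1`.
(3) THE VALUE: ★ P2 `eval_charpoly_genMoebius_fin_two`: `χ_{g′}(a₁)·D(a)²·det D(g) = Δ²·χ(a)`, so `|χ_{g′}(a₁)| = |c|²·|c|^{2j+1}∕(|c|²·|c|²) = |c|^{2j−1}`.  (4) THE DERIVATIVE: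
`tr g′·det D(g) = tr N(g)·tr D(g) − tr(N(g)D(g))` (★ α `trace_mul_inv_mul_det_fin_two`) and the polynomial identity
`(tr g′·det D(g))·D(a) − 2N(a)·det D(g) = Δ·(f·D(a) + 2(c−θ′)·χ(a))` give `|tr g′ − 2a₁| ≤ |c|·max(|c|^{j+1}·|c|, |c|^{2j+1})∕|c|³ = |c|^j`.  Count-neutral CM glue; nothing
printed is asserted.
HONEST LABEL: L2-3 remains THE WALL at the CM-glue layer until every row of CENSUS-L23-CM is paid and `stub_liftInterior_dy` lands; the wall's type-(2) exponent site ★ :321 is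
Eisenstein-data work (★ (P2d-α) `exists_eisensteinData_at_place` ∕ the affine centres), not θ-glue; HC_CM is proved only modulo the 7 printed citations (2 remaining: hLiu418 =
stmt-HodgeConjecture-24832, h413 = stmt-HodgeConjecture-24833) until rung 0 closes.

## References
* [Kottwitz1986BaseChangeUnits] R. E. Kottwitz, *Base change for unit elements of Hecke algebras*, Compositio Math. 60 (1986): §2 pp. 244–247.
* [Rogawski1990] J. D. Rogawski, *Automorphic Representations of Unitary Groups in Three Variables*, Ann. of Math. Stud. 123 (1990): §4.9 Prop. 4.9.1 (b) p. 55, Lemma 4.9.3 p. 56.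
* [HornJohnson2013] R. A. Horn, C. R. Johnson, *Matrix Analysis*, 2nd ed. (2013): §1.2.
* [SerreLocalFields1979] J.-P. Serre, *Local Fields*, GTM 67 (1979): Ch. I §§1–2.
-/

set_option autoImplicit false

noncomputable section

open Matrix Polynomial
open scoped WithZero

namespace Literature.NumberTheory.Automorphic.MoebiusShift

open Literature.NumberTheory.Automorphic.UnitaryLatticeTree

section FieldOnly

variable {K : Type*} [Field K]

/-- The characteristic polynomial of the affine image `x•g + y•1` at the affine image `xa + y` of a scalar (`2 × 2`):
`(xa + y)² − tr(x•g + y•1)(xa + y) + det(x•g + y•1) = x²·(a² − tr g·a + det g)`. [cite: HornJohnson2013, §1.2] -/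
theorem sq_sub_trace_smul_add_mul_add_det_eq (g : Matrix (Fin 2) (Fin 2) K) (x y a : K) :
    (x * a + y) * (x * a + y) - (x • g + y • (1 : Matrix (Fin 2) (Fin 2) K)).trace * (x * a + y) + (x • g + y • (1 : Matrix (Fin 2) (Fin 2) K)).det =
      x ^ 2 * (a * a - g.trace * a + g.det) := by
  rw [det_smul_add_smul_one_fin_two]
  simp [Matrix.trace_fin_two]
  ring

/-- The trace identity behind the derivative of the shifted centre (`2 × 2`, hermitian pair, `θ + θ′ = 1`): with `N = θ•g + (c−θ)•1`, `Dm = (c−θ′)•g + θ′•1`,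
`(tr N·tr Dm − tr(N·Dm))·((c−θ′)a + θ′) − 2(θa + (c−θ))·det Dm = (θθ′ − (c−θ)(c−θ′))·((tr g − 2a)((c−θ′)a + θ′) + 2(c−θ′)(a² − tr g·a + det g))`.
[cite: HornJohnson2013, §1.2] [cite: Kottwitz1986BaseChangeUnits, §2 pp. 244–247] -/
theorem hermitianMoebius_centre_trace_identity (g : Matrix (Fin 2) (Fin 2) K) (θ θ' c a : K) :
    ((θ • g + (c - θ) • (1 : Matrix (Fin 2) (Fin 2) K)).trace * ((c - θ') • g + θ' • (1 : Matrix (Fin 2) (Fin 2) K)).trace -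
        ((θ • g + (c - θ) • (1 : Matrix (Fin 2) (Fin 2) K)) * ((c - θ') • g + θ' • (1 : Matrix (Fin 2) (Fin 2) K))).trace) * ((c - θ') * a + θ') -
      2 * (θ * a + (c - θ)) * ((c - θ') • g + θ' • (1 : Matrix (Fin 2) (Fin 2) K)).det =
      (θ * θ' - (c - θ) * (c - θ')) * ((g.trace - 2 * a) * ((c - θ') * a + θ') + 2 * (c - θ') * (a * a - g.trace * a + g.det)) := by
  rw [det_smul_add_smul_one_fin_two]
  simp [Matrix.trace_fin_two, Matrix.det_fin_two, Matrix.mul_apply, Fin.sum_univ_two, Matrix.add_apply, Matrix.smul_apply, Matrix.one_apply]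
  ring

end FieldOnly

section Valued

variable {K : Type*} [Field K] [Valued K ℤᵐ⁰]

/-- **Root-free trichotomy**: if `x² − Tx + d = ε` with `|T| ≤ |c|`, `|d| = |c|²`, `|ε| < |c|²`, then `|x| = |c|` — for `|x| < |c|` the constant term dominates, for `|x| > |c|` the
square dominates, and either way `|x² − Tx + d| ≥ |c|² > |ε|`. [cite: SerreLocalFields1979, Ch. I §§1–2] -/
theorem valued_eq_of_quadratic_near_root {x T d ε c : K} (hT : Valued.v T ≤ Valued.v c) (hd : Valued.v d = Valued.v c ^ 2) (hε : Valued.v ε < Valued.v c ^ 2)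
    (h : x * x - T * x + d = ε) : Valued.v x = Valued.v c := by
  have hc0 : Valued.v c ≠ 0 := fun h0 => by rw [h0, zero_pow two_ne_zero] at hε; exact not_lt_of_ge zero_le hε
  have hcpos : 0 < Valued.v c := lt_of_le_of_ne zero_le (Ne.symm hc0)
  rcases lt_trichotomy (Valued.v x) (Valued.v c) with hlt | heq | hgt
  · exfalso
    have h1 : Valued.v (x * x - T * x) < Valued.v c ^ 2 := by
      refine lt_of_le_of_lt (Valuation.map_sub _ _ _) (max_lt ?_ ?_)
      · rw [map_mul, sq]
        calc Valued.v x * Valued.v x ≤ Valued.v x * Valued.v c := mul_le_mul' le_rfl hlt.le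
          _ < Valued.v c * Valued.v c := mul_lt_mul_of_pos_right hlt hcpos
      · rw [map_mul, sq]
        calc Valued.v T * Valued.v x ≤ Valued.v c * Valued.v x := mul_le_mul' hT le_rfl
          _ < Valued.v c * Valued.v c := mul_lt_mul_of_pos_left hlt hcpos
    have h2 : Valued.v (x * x - T * x + d) = Valued.v d := Valuation.map_add_eq_of_lt_right _ (by rw [hd]; exact h1)
    rw [h, hd] at h2
    exact (lt_irrefl _) (h2 ▸ hε)
  · exact heq
  · exfalso
    have hxpos : 0 < Valued.v x := lt_of_le_of_lt zero_le hgt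
    have h1 : Valued.v (-(T * x) + d) < Valued.v (x * x) := by
      refine lt_of_le_of_lt (Valuation.map_add _ _ _) (max_lt ?_ ?_)
      · rw [Valuation.map_neg, map_mul, map_mul]
        calc Valued.v T * Valued.v x ≤ Valued.v c * Valued.v x := mul_le_mul' hT le_rfl
          _ < Valued.v x * Valued.v x := mul_lt_mul_of_pos_right hgt hxpos
      · rw [hd, map_mul, sq]
        calc Valued.v c * Valued.v c < Valued.v c * Valued.v x := mul_lt_mul_of_pos_left hgt hcpos
          _ ≤ Valued.v x * Valued.v x := mul_le_mul' hgt.le le_rfl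
    have h2 : Valued.v (x * x + (-(T * x) + d)) = Valued.v (x * x) := Valuation.map_add_eq_of_lt_left _ h1
    rw [show x * x + (-(T * x) + d) = x * x - T * x + d by ring, h, map_mul] at h2
    have h3 : Valued.v c ^ 2 < Valued.v x * Valued.v x := by
      rw [sq]
      calc Valued.v c * Valued.v c < Valued.v c * Valued.v x := mul_lt_mul_of_pos_left hgt hcpos
        _ ≤ Valued.v x * Valued.v x := mul_le_mul' hgt.le le_rfl
    exact (lt_irrefl _) ((hε.trans h3).trans_eq h2.symm)

/-- **«CENTRE-SHIFT-θ» — THE ADMISSIBLE EISENSTEIN CENTRE UNDER THE HERMITIAN CAYLEY SHIFT** (2-free; row 8 of CENSUS-L23-CM v1, the `(a′, f′, e″, j − 1)` of ★ p853676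
`stableOrbitalIntegralRel_chi_shift_of_not_exists_isRoot_affine`).  For `θ + θ′ = 1`, `|θ| ≤ 1`, `|c| = exp(−1)`, a `2 × 2` matrix `g ≡ 1 (mod c²)` entrywise, and an admissible centre
`(a, f, e′, j)` of `g` with `j ≥ 1` — `tr g − 2a = f`, `|f| ≤ |c|^{j+1}`, `a² − tr g·a + det g = −e′`, `|e′| = |c|^{2j+1}` (the integrality of `a` is not even used: it
FOLLOWS, `|(c−θ′)a + θ′| = |c|`) —: with `g′ = (θ•g + (c−θ)•1)((c−θ′)•g + θ′•1)⁻¹` and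
`a₁ = (θa + (c−θ))∕((c−θ′)a + θ′)`: `|a₁| ≤ 1` and there are `f₁ e₁′` with `tr g′ − 2a₁ = f₁`, `a₁a₁ − tr g′·a₁ + det g′ = −e₁′`, `|f₁| ≤ |c|^{(j−1)+1}`, `|e₁′| = |c|^{2(j−1)+1}`.
[cite: Rogawski1990, §4.9 Prop. 4.9.1 (b) p. 55, Lemma 4.9.3 p. 56] [cite: Kottwitz1986BaseChangeUnits, §2 pp. 244–247] [cite: SerreLocalFields1979, Ch. I §§1–2] -/
theorem hermitianMoebius_admissibleCentre {θ θ' c : K} (hθ : θ + θ' = 1) (hθv : Valued.v θ ≤ 1) (hc : Valued.v c = WithZero.exp (-1 : ℤ))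
    (g : Matrix (Fin 2) (Fin 2) K) (hg2 : ∀ i k, Valued.v ((g - 1) i k) ≤ Valued.v c ^ 2)
    {a f e' : K} {j : ℕ} (hj1 : 1 ≤ j) (hf : Valued.v f ≤ Valued.v c ^ (j + 1)) (he : Valued.v e' = Valued.v c ^ (2 * j + 1))
    (htf : g.trace - 2 * a = f) (hde : a * a - g.trace * a + g.det = -e') :
    Valued.v ((θ * a + (c - θ)) / ((c - θ') * a + θ')) ≤ 1 ∧
      ∃ f₁ e₁' : K,
        ((θ • g + (c - θ) • (1 : Matrix (Fin 2) (Fin 2) K)) * ((c - θ') • g + θ' • (1 : Matrix (Fin 2) (Fin 2) K))⁻¹).trace - 2 * ((θ * a + (c - θ)) / ((c - θ') * a + θ')) = f₁ ∧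
        (θ * a + (c - θ)) / ((c - θ') * a + θ') * ((θ * a + (c - θ)) / ((c - θ') * a + θ')) -
            ((θ • g + (c - θ) • (1 : Matrix (Fin 2) (Fin 2) K)) * ((c - θ') • g + θ' • (1 : Matrix (Fin 2) (Fin 2) K))⁻¹).trace * ((θ * a + (c - θ)) / ((c - θ') * a + θ')) +
          ((θ • g + (c - θ) • (1 : Matrix (Fin 2) (Fin 2) K)) * ((c - θ') • g + θ' • (1 : Matrix (Fin 2) (Fin 2) K))⁻¹).det = -e₁' ∧
        Valued.v f₁ ≤ Valued.v c ^ (j - 1 + 1) ∧ Valued.v e₁' = Valued.v c ^ (2 * (j - 1) + 1) := by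
  obtain ⟨hc0, hc1, -, -, -, -⟩ := shift_parameter_facts hc
  have hvc0 : Valued.v c ≠ 0 := (Valuation.ne_zero_iff _).2 hc0
  have hcpos : 0 < Valued.v c := lt_of_le_of_ne zero_le (Ne.symm hvc0)
  -- the scalars: `θ′ = 1 − θ`, `R = c − θ′`, `Δ = c(1 − c)`
  have hθ'v : Valued.v θ' ≤ 1 := by
    rw [show θ' = 1 - θ by rw [← hθ]; ring]
    exact (Valuation.map_sub _ _ _).trans (max_le (le_of_eq (Valuation.map_one _)) hθv)
  have hRv : Valued.v (c - θ') ≤ 1 := (Valuation.map_sub _ _ _).trans (max_le hc1.le hθ'v)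
  have h1c : Valued.v (1 - c) = 1 := Valuation.map_one_sub_of_lt _ hc1
  have h2v : Valued.v (2 : K) ≤ 1 := by
    rw [show (2 : K) = 1 + 1 by norm_num]; exact Valuation.map_add_le _ (le_of_eq (Valuation.map_one _)) (le_of_eq (Valuation.map_one _))
  have hΔ : θ * θ' - (c - θ) * (c - θ') = c * (1 - c) := by linear_combination c * hθ
  have hvΔ : Valued.v (θ * θ' - (c - θ) * (c - θ')) = Valued.v c := by rw [hΔ, map_mul, h1c, mul_one]
  have hΔ0 : θ * θ' - (c - θ) * (c - θ') ≠ 0 := fun h0 => by rw [h0, map_zero] at hvΔ; exact hvc0 hvΔ.symm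
  -- `g = 1 + c•X` with `X ≡ 0 (mod c)`
  set X : Matrix (Fin 2) (Fin 2) K := c⁻¹ • (g - 1) with hX
  have hgX : g = 1 + c • X := eq_one_add_smul_inv_smul_sub_one hc0 g
  have hXc : ∀ i k, Valued.v (X i k) ≤ Valued.v c := by
    intro i k
    rw [hX, Matrix.smul_apply, smul_eq_mul, map_mul, map_inv₀]
    calc (Valued.v c)⁻¹ * Valued.v ((g - 1) i k) ≤ (Valued.v c)⁻¹ * Valued.v c ^ 2 := mul_le_mul_right (hg2 i k) _
      _ = Valued.v c := by rw [sq, ← mul_assoc, inv_mul_cancel₀ hvc0, one_mul]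
  have hdetX : ∀ {s : K}, Valued.v s ≤ 1 → Valued.v (((1 : Matrix (Fin 2) (Fin 2) K) + s • X).det) = 1 := by
    intro s hs
    refine v_det_eq_one_of_forall_v_sub_one_lt_one _ fun i k => ?_
    rw [add_sub_cancel_left, Matrix.smul_apply, smul_eq_mul, map_mul]
    exact lt_of_le_of_lt (mul_le_of_le_one_left' hs) ((hXc i k).trans_lt hc1)
  -- the two affine images of `g`: `Dm = (c−θ′)•g + θ′•1 = c•(1 + (c−θ′)X)`, `Nm = θ•g + (c−θ)•1 = c•(1 + θX)`
  set Dm : Matrix (Fin 2) (Fin 2) K := (c - θ') • g + θ' • 1 with hDm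
  set Nm : Matrix (Fin 2) (Fin 2) K := θ • g + (c - θ) • 1 with hNm
  have hDmX : Dm = c • ((1 : Matrix (Fin 2) (Fin 2) K) + (c - θ') • X) := by
    rw [hDm, hgX]; exact smul_one_add_smul_add_smul_one_of_add_eq X c (c - θ') θ' (by ring)
  have hNmX : Nm = c • ((1 : Matrix (Fin 2) (Fin 2) K) + θ • X) := by
    rw [hNm, hgX]; exact smul_one_add_smul_add_smul_one_of_add_eq X c θ (c - θ) (by ring)
  have hvdD : Valued.v Dm.det = Valued.v c ^ 2 := by
    rw [hDmX, Matrix.det_smul, Fintype.card_fin, map_mul, map_pow, hdetX hRv, mul_one]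
  have hvdN : Valued.v Nm.det = Valued.v c ^ 2 := by
    rw [hNmX, Matrix.det_smul, Fintype.card_fin, map_mul, map_pow, hdetX hθv, mul_one]
  have hdD0 : Dm.det ≠ 0 := fun h0 => by rw [h0, map_zero] at hvdD; exact pow_ne_zero 2 hvc0 hvdD.symm
  -- traces: `tr Dm = (c−θ′)(t − 2) + 2c`, `tr Nm = θ(t − 2) + 2c`, both of valuation `≤ |c|`
  have ht2 : Valued.v (g.trace - 2) ≤ Valued.v c := by
    have e : g.trace - 2 = (g - 1) 0 0 + (g - 1) 1 1 := by
      simp [Matrix.trace_fin_two, Matrix.sub_apply]; ring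
    rw [e]
    exact Valuation.map_add_le _ ((hg2 0 0).trans (by rw [sq]; exact mul_le_of_le_one_left' hc1.le)) ((hg2 1 1).trans (by rw [sq]; exact mul_le_of_le_one_left' hc1.le))
  have htrlin : ∀ x y : K, (x • g + y • (1 : Matrix (Fin 2) (Fin 2) K)).trace = x * (g.trace - 2) + 2 * (x + y) := fun x y => by
    simp [Matrix.trace_fin_two]; ring
  have hvtr : ∀ {x y : K}, Valued.v x ≤ 1 → x + y = c → Valued.v (x • g + y • (1 : Matrix (Fin 2) (Fin 2) K)).trace ≤ Valued.v c := by
    intro x y hx hxy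
    rw [htrlin, hxy]
    refine Valuation.map_add_le _ ?_ ?_
    · rw [map_mul]; exact (mul_le_mul' hx ht2).trans_eq (one_mul _)
    · rw [map_mul]; exact (mul_le_mul' h2v le_rfl).trans_eq (one_mul _)
  have hvtrD : Valued.v Dm.trace ≤ Valued.v c := hvtr hRv (by ring)
  have hvtrN : Valued.v Nm.trace ≤ Valued.v c := hvtr hθv (by ring)
  -- the centre: `χ(a) = −e′` has valuation `|c|^{2j+1} < |c|²`
  have hχ : Valued.v (a * a - g.trace * a + g.det) = Valued.v c ^ (2 * j + 1) := by rw [hde, Valuation.map_neg, he]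
  have hχlt : Valued.v (a * a - g.trace * a + g.det) < Valued.v c ^ 2 := by
    rw [hχ]; exact pow_lt_pow_right_of_lt_one₀ hcpos hc1 (by omega)
  -- `|D(a)| = |c| = |N(a)|` by the root-free trichotomy applied to the affine images
  set Da : K := (c - θ') * a + θ' with hDa
  set Na : K := θ * a + (c - θ) with hNa
  have hqD : Da * Da - Dm.trace * Da + Dm.det = (c - θ') ^ 2 * (a * a - g.trace * a + g.det) := sq_sub_trace_smul_add_mul_add_det_eq g (c - θ') θ' a
  have hqN : Na * Na - Nm.trace * Na + Nm.det = θ ^ 2 * (a * a - g.trace * a + g.det) := sq_sub_trace_smul_add_mul_add_det_eq g θ (c - θ) a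
  have hsmall : ∀ {x : K}, Valued.v x ≤ 1 → Valued.v (x ^ 2 * (a * a - g.trace * a + g.det)) < Valued.v c ^ 2 := fun {x} hx => by
    rw [map_mul, map_pow]
    exact lt_of_le_of_lt (mul_le_of_le_one_left' (pow_le_one₀ zero_le hx)) hχlt
  have hvDa : Valued.v Da = Valued.v c := valued_eq_of_quadratic_near_root hvtrD hvdD (hsmall hRv) hqD
  have hvNa : Valued.v Na = Valued.v c := valued_eq_of_quadratic_near_root hvtrN hvdN (hsmall hθv) hqN
  have hDa0 : Da ≠ 0 := fun h0 => by rw [h0, map_zero] at hvDa; exact hvc0 hvDa.symm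
  have ha₁ : Valued.v (Na / Da) = 1 := by rw [map_div₀, hvNa, hvDa, div_self hvc0]
  refine ⟨ha₁.le, (Nm * Dm⁻¹).trace - 2 * (Na / Da), -((Na / Da) * (Na / Da) - (Nm * Dm⁻¹).trace * (Na / Da) + (Nm * Dm⁻¹).det), rfl, (neg_neg _).symm, ?_, ?_⟩
  · -- the derivative: `(tr g′ − 2a₁)·(det Dm·D(a)) = Δ·(f·D(a) + 2(c−θ′)χ(a))`
    have htr := trace_mul_inv_mul_det_fin_two Nm Dm hdD0
    have hid := hermitianMoebius_centre_trace_identity g θ θ' c a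
    have hkey : ((Nm * Dm⁻¹).trace - 2 * (Na / Da)) * (Dm.det * Da) =
        (θ * θ' - (c - θ) * (c - θ')) * ((g.trace - 2 * a) * Da + 2 * (c - θ') * (a * a - g.trace * a + g.det)) := by
      rw [← hid, ← htr]
      field_simp
      ring
    have hval : Valued.v (((Nm * Dm⁻¹).trace - 2 * (Na / Da)) * (Dm.det * Da)) ≤ Valued.v c * Valued.v c ^ (j + 2) := by
      rw [hkey, map_mul, hvΔ, htf]
      refine mul_le_mul' le_rfl ((Valuation.map_add _ _ _).trans (max_le ?_ ?_))
      · rw [map_mul, hvDa, pow_succ]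
        exact mul_le_mul' hf le_rfl
      · rw [map_mul, map_mul, hχ]
        calc Valued.v 2 * Valued.v (c - θ') * Valued.v c ^ (2 * j + 1) ≤ 1 * 1 * Valued.v c ^ (2 * j + 1) :=
              mul_le_mul' (mul_le_mul' h2v hRv) le_rfl
          _ = Valued.v c ^ (2 * j + 1) := by rw [one_mul, one_mul]
          _ ≤ Valued.v c ^ (j + 2) := pow_le_pow_right_of_le_one' hc1.le (by omega)
    rw [map_mul, map_mul, hvdD, hvDa, ← pow_succ] at hval
    rw [show j - 1 + 1 = j by omega]
    have hpos : 0 < Valued.v c ^ (2 + 1) := pow_pos hcpos _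
    have hpw : Valued.v c * Valued.v c ^ (j + 2) = Valued.v c ^ j * Valued.v c ^ (2 + 1) := by
      rw [← pow_succ', ← pow_add]
    rw [hpw] at hval
    have h' : Valued.v ((Nm * Dm⁻¹).trace - 2 * (Na / Da)) ≤ Valued.v c ^ j * Valued.v c ^ (2 + 1) / Valued.v c ^ (2 + 1) :=
      (le_div_iff₀ hpos).2 hval
    rwa [mul_div_cancel_right₀ _ (ne_of_gt hpos)] at h'
  · -- the value: `χ_{g′}(a₁)·D(a)²·det Dm = Δ²·χ(a)`
    have hev := eval_charpoly_genMoebius_fin_two g θ (c - θ) θ' (c - θ') a hdD0 hDa0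
    have hev' : ((Na / Da) * (Na / Da) - (Nm * Dm⁻¹).trace * (Na / Da) + (Nm * Dm⁻¹).det) * Da ^ 2 * Dm.det =
        (θ * θ' - (c - θ) * (c - θ')) ^ 2 * (a * a - g.trace * a + g.det) := by
      have e1 : (Nm * Dm⁻¹).charpoly.eval (Na / Da) = (Na / Da) * (Na / Da) - (Nm * Dm⁻¹).trace * (Na / Da) + (Nm * Dm⁻¹).det := by
        rw [Matrix.charpoly_fin_two]; simp only [eval_add, eval_sub, eval_mul, eval_pow, eval_C, eval_X]; ring
      have e2 : g.charpoly.eval a = a * a - g.trace * a + g.det := by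
        rw [Matrix.charpoly_fin_two]; simp only [eval_add, eval_sub, eval_mul, eval_pow, eval_C, eval_X]; ring
      rw [← e1, ← e2]
      exact hev
    have hval := congrArg Valued.v hev'
    rw [map_mul, map_mul, map_pow, hvDa, hvdD, map_mul, map_pow, hvΔ, hχ] at hval
    -- `v(e₁′)·|c|⁴ = |c|^{2j+3}`
    rw [Valuation.map_neg, show 2 * (j - 1) + 1 = 2 * j - 1 by omega]
    have hpow : Valued.v c ^ 2 * Valued.v c ^ (2 * j + 1) = Valued.v c ^ (2 * j - 1) * (Valued.v c ^ 2 * Valued.v c ^ 2) := by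
      rw [← pow_add, ← pow_add, ← pow_add]; congr 1; omega
    rw [mul_assoc, hpow] at hval
    exact mul_right_cancel₀ (mul_ne_zero (pow_ne_zero 2 hvc0) (pow_ne_zero 2 hvc0)) hval

end Valued

end Literature.NumberTheory.Automorphic.MoebiusShift

end
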